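import Summits.AtomisticToContinuum.Crystallization.Theorems.ChartedZeroExcessLayeredLatticeLiouvilleZZZYRCZU
import Summits.AtomisticToContinuum.Crystallization.Theorems.ChartedZeroExcessLayeredLatticeLiouvilleZZZYRCZS

/-!
# ZZZYRCXRX — REVERSAL TRANSPORT of the windowed kernel contract (binder 26636, line (D); lens-2 g101)

Critic r1902 (C) / r1903 (1) asked for the two symmetry transports of the kernel contract `KernelSlabSoundF` (ZZZYRCZU) that cut the
production of per-type tables: the S₃ letter relabelling («ZZZYRCXRW», In half) and the LAYER REVERSAL (this file). The reversal
`m ↦ 2H₀ − m` of the window is LETTER-FREE: it maps the window word `wd` (length `2H₀+1`) to `wd.reverse`, a centre-based chord datum to the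
datum with every node's layer reflected (`revChord`), a letter sequence `ℓ` to `revLetters (2H₀) ℓ = ℓ ∘ (2H₀ − ·)`, and a raw piece key
`(d, Δγ₀, Δγ₁, Δm)` to `revKey H₀ = (2H₀ − d, Δγ₀, Δγ₁, −Δm)` (an involution). The SITE / PAIR / LETTER maps are those of ZZZYRCZS §2
(`revSite c`, `revPair c`, `revLetters c`, `revPair_revPair`, `n9F_rev`, `d18F_rev` — the configuration/ideal-side reversal of g100) at the
centre `c := 2H₀`; THIS file is the kernel-contract-side reversal (chord data, piece keys, guarded tables, the contracts) and declares no third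
site map. Every integer ideal quantity of ZZZYRCZO (`n9F`, `d18F`, hence `coefR0F`, `coefN0F`) is invariant, `PiecesWithin`, `IsCenterBased`
and the out-of-window condition are invariant, so:

* `thetaR0G_rev` / `thetaN0G_rev`: the guarded tables of the reversed data under `ℓ` are the tables of the data under `revLetters (2H₀) ℓ` at
  the reflected key;
* ★ `kernelSlabSoundF_reverse`: `KernelSlabSoundF H₀ R wd … cd TR TN → KernelSlabSoundF H₀ R wd.reverse … (cd.map (revChord H₀)) (TR ∘ revKey H₀)
  (TN ∘ revKey H₀)` (needs only `wd.length = 2H₀+1`); ★ `kernelSlabSoundOut_reverse`: the same for the OUT half `KernelSlabSoundOut`.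

So a word and its reversal need ONE kernel certification; the tables of the other are read off by re-keying. No padding of `R`, `P9max`
or the range `(lo, hi]` is needed. Def-free except `revChord`, `revKey`. Imports ZZZYRCZU + ZZZYRCZS (siblings under ZZZYRCZQ; cycle-free).
(memo HOME/decomp-a2c-lens-2/g101/memo/S3-TRANSPORT-g101.md; v2 = r1908 (C1) dedup fix: the five g100 homonyms reused, not re-declared)
-/

namespace Summit.AtomisticToContinuum.Crystallization.Theorems.ChartedZeroExcessLayeredLatticeLiouville

/-! ### §1 the re-keying functions (site / pair / letter maps = ZZZYRCZS §2 at centre `c := 2H₀`) -/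

/-- reflect a chord datum through the window centre `H₀` (layer `m ↦ 2H₀ − m`): endpoints and every interior path node, by the ZZZYRCZS
site map `revSite (2H₀)`. [g101] -/
def revChord (H₀ : ℕ) (c : ChordDatum) : ChordDatum := (revPair (2 * (H₀ : ℤ)) c.1, c.2.map (revSite (2 * (H₀ : ℤ))))

/-- reflect a raw piece key: `(d, Δγ₀, Δγ₁, Δm) ↦ (2H₀ − d, Δγ₀, Δγ₁, −Δm)`. [g101] -/
def revKey (H₀ : ℕ) (k : ℤ × ℤ × ℤ × ℤ) : ℤ × ℤ × ℤ × ℤ := (2 * (H₀ : ℤ) - k.1, k.2.1, k.2.2.1, -k.2.2.2)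

/-! ### §2 involution and injectivity -/

/-- `revKey` is an involution. [g101] -/
theorem revKey_revKey (H₀ : ℕ) (k : ℤ × ℤ × ℤ × ℤ) : revKey H₀ (revKey H₀ k) = k := by
  obtain ⟨d, g0, g1, dm⟩ := k
  simp only [revKey, neg_neg, sub_sub_cancel]

/-- `revKey a = k ↔ a = revKey k`. [g101] -/
theorem revKey_eq_iff (H₀ : ℕ) (a k : ℤ × ℤ × ℤ × ℤ) : revKey H₀ a = k ↔ a = revKey H₀ k := by
  constructor
  · rintro rfl; rw [revKey_revKey]
  · rintro rfl; rw [revKey_revKey]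

/-- `revPair` (ZZZYRCZS) is injective. [g101] -/
theorem revPair_injective (c : ℤ) : Function.Injective (revPair c) := fun x y h => by
  rw [← revPair_revPair c x, h, revPair_revPair]

/-- the far pair of the reflected datum. [g101] -/
theorem revChord_fst (H₀ : ℕ) (c : ChordDatum) : (revChord H₀ c).1 = revPair (2 * (H₀ : ℤ)) c.1 := rfl

/-! ### §3 invariance of the integer ideal geometry -/

/-- `n9` of the reflected pair under `ℓ` = `n9` of the pair under the reflected sequence (ZZZYRCZS `n9F_revLetters`, read backwards). [g101] -/
theorem n9F_revPair (c : ℤ) (ℓ : ℤ → ℤ) (x : (Cell 2 × ℤ) × (Cell 2 × ℤ)) : n9F ℓ (revPair c x) = n9F (revLetters c ℓ) x :=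
  (n9F_revLetters c ℓ x).symm

/-- `d18` likewise (from ZZZYRCZS `d18F_rev` by the involution). [g101] -/
theorem d18F_revPair (c : ℤ) (ℓ : ℤ → ℤ) (x q : (Cell 2 × ℤ) × (Cell 2 × ℤ)) :
    d18F ℓ (revPair c x) (revPair c q) = d18F (revLetters c ℓ) x q := by
  have h := d18F_rev c ℓ (revPair c x) (revPair c q)
  rw [revPair_revPair, revPair_revPair] at h
  exact h.symm

/-- piece count is invariant. [g101] -/
theorem chordNp_rev (H₀ : ℕ) (c : ChordDatum) : chordNp (revChord H₀ c) = chordNp c := by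
  simp only [chordNp, revChord, List.length_map]

/-- the node list of the reflected datum is the reflected node list. [g101] -/
theorem chordNodes_rev (H₀ : ℕ) (c : ChordDatum) : chordNodes (revChord H₀ c) = (chordNodes c).map (revSite (2 * (H₀ : ℤ))) := by
  simp only [chordNodes, revChord, revPair, List.map_cons, List.map_append, List.map_nil]

/-- the pieces of the reflected datum are the reflected pieces. [g101] -/
theorem chordPiece_rev (H₀ : ℕ) (c : ChordDatum) (i : ℕ) : chordPiece (revChord H₀ c) i = revPair (2 * (H₀ : ℤ)) (chordPiece c i) := by
  have h2 : (revChord H₀ c).1.2 = revSite (2 * (H₀ : ℤ)) c.1.2 := rfl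
  simp only [chordPiece, chordNodes_rev, h2, List.getD_map]
  rfl

/-- the raw key of a reflected piece is the reflected key. [g101] -/
theorem pieceKeyF_rev (H₀ : ℕ) (q : (Cell 2 × ℤ) × (Cell 2 × ℤ)) : pieceKeyF (revPair (2 * (H₀ : ℤ)) q) = revKey H₀ (pieceKeyF q) := by
  simp only [pieceKeyF, revPair, revSite, revKey, Prod.mk.injEq]
  exact ⟨trivial, trivial, trivial, by ring⟩

/-- the ideal R coefficient is invariant. [g101] -/
theorem coefR0F_rev (H₀ : ℕ) (ℓ : ℤ → ℤ) (c : ChordDatum) : coefR0F ℓ (revChord H₀ c) = coefR0F (revLetters (2 * (H₀ : ℤ)) ℓ) c := by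
  simp only [coefR0F, chordNp_rev, revChord_fst, n9F_revPair]

/-- the ideal N coefficient is invariant. [g101] -/
theorem coefN0F_rev (H₀ : ℕ) (ℓ : ℤ → ℤ) (c : ChordDatum) (i : ℕ) :
    coefN0F ℓ (revChord H₀ c) i = coefN0F (revLetters (2 * (H₀ : ℤ)) ℓ) c i := by
  simp only [coefN0F, chordNp_rev, chordPiece_rev, revChord_fst, n9F_revPair, d18F_revPair]

/-- ★ the guarded R table of the reflected data under `ℓ` at key `k` is the table of the data under `revLetters (2H₀) ℓ` at `revKey H₀ k`. [g101] -/
theorem thetaR0G_rev (H₀ : ℕ) (ℓ : ℤ → ℤ) (lo hi : ℤ) (cd : List ChordDatum) (k : ℤ × ℤ × ℤ × ℤ) :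
    thetaR0G ℓ lo hi (cd.map (revChord H₀)) k = thetaR0G (revLetters (2 * (H₀ : ℤ)) ℓ) lo hi cd (revKey H₀ k) := by
  unfold thetaR0G
  rw [List.map_map]
  congr 1
  refine List.map_congr_left fun c _ => ?_
  simp only [Function.comp_apply, revChord_fst, n9F_revPair, chordNp_rev, chordPiece_rev, pieceKeyF_rev, revKey_eq_iff, coefR0F_rev]

/-- ★ the guarded N table likewise. [g101] -/
theorem thetaN0G_rev (H₀ : ℕ) (ℓ : ℤ → ℤ) (lo hi : ℤ) (cd : List ChordDatum) (k : ℤ × ℤ × ℤ × ℤ) :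
    thetaN0G ℓ lo hi (cd.map (revChord H₀)) k = thetaN0G (revLetters (2 * (H₀ : ℤ)) ℓ) lo hi cd (revKey H₀ k) := by
  unfold thetaN0G
  rw [List.map_map]
  congr 1
  refine List.map_congr_left fun c _ => ?_
  simp only [Function.comp_apply, revChord_fst, n9F_revPair, chordNp_rev, chordPiece_rev, pieceKeyF_rev, revKey_eq_iff, coefN0F_rev]

/-! ### §4 invariance of the side conditions -/

/-- the periodic letter of the reversed word at the reflected window layer is the letter of the word. [g101] -/
theorem regW_reverse {H₀ : ℕ} {wd : List ℤ} (hlen : wd.length = 2 * H₀ + 1) {j : ℤ} (hj0 : 0 ≤ j) (hj : j ≤ 2 * (H₀ : ℤ)) :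
    regW wd.reverse (2 * (H₀ : ℤ) - j) = regW wd j := by
  obtain ⟨n, rfl⟩ := Int.eq_ofNat_of_zero_le hj0
  have hn : n ≤ 2 * H₀ := by exact_mod_cast hj
  have hcast : (2 * (H₀ : ℤ) - (n : ℤ)) = ((2 * H₀ - n : ℕ) : ℤ) := by omega
  have hp : (0 : ℤ) < ((2 * H₀ + 1 : ℕ) : ℤ) := by positivity
  unfold regW
  rw [List.length_reverse, hlen, hcast, Int.emod_eq_of_lt (by positivity) (by push_cast; omega),
    Int.emod_eq_of_lt (by positivity) (by push_cast; omega), Int.toNat_natCast, Int.toNat_natCast,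
    List.getD_eq_getElem _ _ (by rw [List.length_reverse, hlen]; omega), List.getD_eq_getElem _ _ (by rw [hlen]; omega),
    List.getElem_reverse]
  congr 1
  rw [hlen]; omega

/-- agreement with the reversed word on the window = agreement of the reflected sequence with the word. [g101] -/
theorem agreesOnWindow_rev {H₀ : ℕ} {wd : List ℤ} (hlen : wd.length = 2 * H₀ + 1) {ℓ : ℤ → ℤ} (h : AgreesOnWindow H₀ wd.reverse ℓ) :
    AgreesOnWindow H₀ wd (revLetters (2 * (H₀ : ℤ)) ℓ) := by
  intro j hj0 hj
  show ℓ (2 * (H₀ : ℤ) - j) = regW wd j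
  rw [h (2 * (H₀ : ℤ) - j) (by omega) (by omega), regW_reverse hlen hj0 hj]

/-- centre-based pairs stay centre-based. [g101] -/
theorem isCenterBased_rev {H₀ : ℕ} {x : (Cell 2 × ℤ) × (Cell 2 × ℤ)} (h : IsCenterBased H₀ x) : IsCenterBased H₀ (revPair (2 * (H₀ : ℤ)) x) := by
  refine ⟨h.1, ?_⟩
  show 2 * (H₀ : ℤ) - x.1.2 = H₀
  rw [h.2]; ring

/-- distance of a reflected layer to the centre is unchanged. [g101] -/
theorem abs_rev_sub (H₀ : ℕ) (m : ℤ) : |2 * (H₀ : ℤ) - m - H₀| = |m - H₀| := by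
  rw [show 2 * (H₀ : ℤ) - m - H₀ = -(m - H₀) by ring, abs_neg]

/-- `PiecesWithin` the centre radius is invariant. [g101] -/
theorem piecesWithin_rev {H₀ R : ℕ} {c : ChordDatum} (h : PiecesWithin (H₀ : ℤ) R c) : PiecesWithin (H₀ : ℤ) R (revChord H₀ c) := by
  intro i hi
  rw [chordNp_rev] at hi
  rw [chordPiece_rev]
  show |2 * (H₀ : ℤ) - (chordPiece c i).1.2 - H₀| ≤ R ∧ |2 * (H₀ : ℤ) - (chordPiece c i).2.2 - H₀| ≤ R
  rw [abs_rev_sub, abs_rev_sub]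
  exact h i hi

/-- the far pairs of the reflected data are the reflected far pairs. [g101] -/
theorem map_fst_revChord (H₀ : ℕ) (cd : List ChordDatum) :
    (cd.map (revChord H₀)).map (·.1) = (cd.map (·.1)).map (revPair (2 * (H₀ : ℤ))) := by
  simp only [List.map_map]
  rfl

/-! ### §5 ★ the transports -/

/-- ★★ **REVERSAL TRANSPORT of the windowed kernel contract**: the contract for the window word `wd` yields the contract for `wd.reverse`
with the reflected data and the re-keyed tables `T ∘ revKey H₀`. [g101] -/
theorem kernelSlabSoundF_reverse {H₀ R : ℕ} {wd : List ℤ} {lo hi P9max : ℤ} {E : ℕ} {cd : List ChordDatum}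
    {TRz TNz : ℤ × ℤ × ℤ × ℤ → ℤ} (hlen : wd.length = 2 * H₀ + 1) (h : KernelSlabSoundF H₀ R wd lo hi P9max E cd TRz TNz) :
    KernelSlabSoundF H₀ R wd.reverse lo hi P9max E (cd.map (revChord H₀)) (fun k => TRz (revKey H₀ k)) fun k => TNz (revKey H₀ k) := by
  intro ℓ hℓ hag
  obtain ⟨⟨hV, hnd, hcomp⟩, hT⟩ := h (revLetters (2 * (H₀ : ℤ)) ℓ) (isLetterSeq_revLetters (2 * (H₀ : ℤ)) hℓ) (agreesOnWindow_rev hlen hag)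
  refine ⟨⟨?_, ?_, ?_⟩, fun k => ?_⟩
  · intro c' hc'
    obtain ⟨c, hc, rfl⟩ := List.mem_map.1 hc'
    obtain ⟨hcb, hpw, hpc⟩ := hV c hc
    refine ⟨isCenterBased_rev hcb, piecesWithin_rev hpw, fun hlo hhi i hi => ?_⟩
    rw [revChord_fst, n9F_revPair] at hlo hhi
    rw [chordNp_rev] at hi
    rw [chordPiece_rev, n9F_revPair]
    exact hpc hlo hhi i hi
  · rw [map_fst_revChord]
    exact hnd.map (revPair_injective (2 * (H₀ : ℤ)))
  · intro x hx hlo hhi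
    rw [← revPair_revPair (2 * (H₀ : ℤ)) x, n9F_revPair] at hlo hhi
    obtain ⟨c, hc, hc1⟩ := hcomp (revPair (2 * (H₀ : ℤ)) x) (isCenterBased_rev hx) hlo hhi
    exact ⟨revChord H₀ c, List.mem_map.2 ⟨c, hc, rfl⟩, by rw [revChord_fst, hc1, revPair_revPair]⟩
  · rw [thetaR0G_rev, thetaN0G_rev]
    exact hT (revKey H₀ k)

/-- ★ **REVERSAL TRANSPORT of the OUT half** (`KernelSlabSoundOut`: the out-of-window condition `H₀ < |far layer − H₀|` is invariant too) —
the contract-level twin of hand-1's `--half up|down` union: the DOWN blocks of a word are the reflected UP blocks of its reversal. [g101] -/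
theorem kernelSlabSoundOut_reverse {H₀ R : ℕ} {wd : List ℤ} {lo hi P9max : ℤ} {E : ℕ} {cd : List ChordDatum}
    {TRz TNz : ℤ × ℤ × ℤ × ℤ → ℤ} (hlen : wd.length = 2 * H₀ + 1) (h : KernelSlabSoundOut H₀ R wd lo hi P9max E cd TRz TNz) :
    KernelSlabSoundOut H₀ R wd.reverse lo hi P9max E (cd.map (revChord H₀)) (fun k => TRz (revKey H₀ k)) fun k => TNz (revKey H₀ k) := by
  intro ℓ hℓ hag
  obtain ⟨hV, hnd, hcomp, hT⟩ := h (revLetters (2 * (H₀ : ℤ)) ℓ) (isLetterSeq_revLetters (2 * (H₀ : ℤ)) hℓ) (agreesOnWindow_rev hlen hag)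
  refine ⟨?_, ?_, ?_, fun k => ?_⟩
  · intro c' hc'
    obtain ⟨c, hc, rfl⟩ := List.mem_map.1 hc'
    obtain ⟨hcb, hout, hpw, hpc⟩ := hV c hc
    refine ⟨isCenterBased_rev hcb, ?_, piecesWithin_rev hpw, fun hlo hhi i hi => ?_⟩
    · show (H₀ : ℤ) < |2 * (H₀ : ℤ) - c.1.2.2 - H₀|
      rw [abs_rev_sub]; exact hout
    · rw [revChord_fst, n9F_revPair] at hlo hhi
      rw [chordNp_rev] at hi
      rw [chordPiece_rev, n9F_revPair]
      exact hpc hlo hhi i hi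
  · rw [map_fst_revChord]
    exact hnd.map (revPair_injective (2 * (H₀ : ℤ)))
  · intro x hx hout hlo hhi
    rw [← revPair_revPair (2 * (H₀ : ℤ)) x, n9F_revPair] at hlo hhi
    have hout' : (H₀ : ℤ) < |(revPair (2 * (H₀ : ℤ)) x).2.2 - H₀| := by
      show (H₀ : ℤ) < |2 * (H₀ : ℤ) - x.2.2 - H₀|
      rw [abs_rev_sub]; exact hout
    obtain ⟨c, hc, hc1⟩ := hcomp (revPair (2 * (H₀ : ℤ)) x) (isCenterBased_rev hx) hout' hlo hhi
    exact ⟨revChord H₀ c, List.mem_map.2 ⟨c, hc, rfl⟩, by rw [revChord_fst, hc1, revPair_revPair]⟩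
  · rw [thetaR0G_rev, thetaN0G_rev]
    exact hT (revKey H₀ k)

/-! ### §6 toy (H₀ = 2): the re-keying on a concrete key and datum -/

/-- toy: at `H₀ = 2` the key `(d, Δγ₀, Δγ₁, Δm) = (1, 2, -1, 3)` reflects to `(3, 2, -1, -3)`. [g101] -/
example : revKey 2 ((1 : ℤ), (2 : ℤ), (-1 : ℤ), (3 : ℤ)) = (3, 2, -1, -3) := by decide

/-- toy: reflecting twice is the identity on a concrete two-piece datum at `H₀ = 2`. [g101] -/
example : revChord 2 (revChord 2 (((![0, 0], 2), (![1, -1], 5)), [(![1, 0], 3)])) = (((![0, 0], 2), (![1, -1], 5)), [(![1, 0], 3)]) := by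
  simp only [revChord, revPair, revSite, List.map_cons, List.map_nil]
  norm_num

end Summit.AtomisticToContinuum.Crystallization.Theorems.ChartedZeroExcessLayeredLatticeLiouville
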